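import Summits.QuantumFields.YangMills.Theorems.FluctuationComparisonRegPrIntLS1aAlphaMemVersionOfRows
import Summits.QuantumFields.YangMills.Theorems.FluctuationComparisonRegPrIntLS1aLevelLawInvariance
import Literature.MathematicalPhysics.QuantumFieldTheory.Balaban1983to89.Node00.Record12MinimiserSelection
import HarnessLib

/-!
# S1a · UV3-NODE §69 — THE (m2) DOOR DOCKED WITH THE ONE-VERSION DOOR: membership of the Γ-averaged canonical version `canonVersion dW (orbAvg ρ_k)` of the run's level-`k`
# density, with δ11 DISCHARGED (✓p820698) and δ7 REDUCED to its two honest residuals («`low`, `up` continuous on the window», «window ⊆ regSet»)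

Cell `ym3-torus` (YM ladder rung R3 = continuum `SU(2)` Yang–Mills on the three-torus — a RUNG: NOT d = 4, NOT infinite volume, NOT a mass gap, NOT Clay).
Width seat «width 8» `ym3-torus-px8` (gen 23), FREE px helper on crux `stmt-QuantumFields-20520`, count-neutral, DEFINITION-FREE, default heartbeats; composition of ✓p822164
`…S1aAlphaMemVersionOfRows.mem_version_of_alphaRows` (the (m2) door for a version) with px17 g20's ✓p820698 `…S1aInvariantVersion` (the Γ-averaged canonical version:
`gaugeInvariant_canonVersion_orbAvg` POINTWISE, `canonVersion_orbAvg_nonneg`, `measurable_canonVersion_orbAvg`, `le_canonVersion_orbAvg_on` ∕ `canonVersion_orbAvg_le_on` =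
a.e. bounds by window-continuous functions ⟹ pointwise; px17 g20 11:51:07Z «YES on the shape»).

WHAT — ★★★ `mem_canonVersion_of_alphaRows` (run `K`, level `k ≤ K`): `BalabanUVClass.Mem (blockAvg ℰp) prm (fun W => e^{E_k}·ρ♮ W)` for
`ρ♮ := canonVersion (fieldMeasure (F.P K) k SU(2)) (orbAvg (resDensity F γ K univ k))`, with ✓p821956's explicit `prm`, from: the typed (α) schemas INCLUDING THE PACKAGE's OWN
a.e. rows `Ineq47AE`∕`Ineq41AE` (no pointwise sandwich is assumed any more); `0 ≤ γ` (δ11 DISCHARGED inside: a.e. gauge invariance of `ρ_k` under every gauge transformation is px17 g20's annex ✓`…S1aLevelLawInvariance.resDensity_comp_gaugeAct_ae_eq`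
— the level-`k` run law is gauge invariant — then ✓p820698's `gaugeInvariant_canonVersion_orbAvg` is pointwise);
`hwin : {PlaqSmall θBal(K−k)} ⊆ Node00.regSet dW ρ_k` (§67.3 (c) in level-`k` currency); `hlowc`∕`hupc : ContinuousOn (low K k) ∕ (up K k)` on the window (δ7 PROPER: print p.263 (c)
«analytic ⟹ continuous»); and every other binder of ✓p822164 verbatim (displayed rows δ8∕R0∕Z0∕δ1∕δ4∕X⊂X̃, displayed UNPRINTED δ2-b `hRegClass`, the LF debt for `e^{E_k}·ρ♮`).
Net effect on the (α) ⟹ class-membership node's binder list (UV3-NODE §69.10): δ11 LEAVES (discharged by ✓p820698), δ7 LEAVES as «pointwise sandwich» and RE-ENTERS as its two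
print-shaped residuals; `hγ : 0 ≤ γ` is the runs' standing range.

WHAT THIS FILE IS NOT: a discharge of `hwin` ∕ `hlowc` ∕ `hupc` or of any displayed row; `MemOfRun`∕S1a (m) (height currency = (R-β1′)); nothing of Bałaban's asserted or
proved; crux 20520, 19936, 19200, `YM3TorusSU2` NOT proved; no registered stub closed; rung R3 = SU(2) YM₃ on T³ — NOT d = 4, NOT infinite volume, NOT a mass gap, NOT Clay.
Sorry-free, axioms standard.

References: T. Bałaban, CMP **102** (1985) 255–275 [Balaban1985UV3] ((41)–(47) pp.266–267, p.263); CMP **98** (1985) 17–51 [Balaban1985Averaging] ((12)–(13) p.19);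
CMP **109** (1987) 249–301 [Balaban1987RG1] ((0.13) p.254).
-/

set_option autoImplicit false

noncomputable section

namespace Summit.QuantumFields.YangMills.Theorems.FluctuationComparisonRegPrIntLS1aAlphaMemCanonVersionOfRows

open Finset MeasureTheory
open scoped BigOperators
open Literature.MathematicalPhysics.QuantumFieldTheory.Balaban1983to89
open T3ContinuumYM3Torus T3UnitScaleTilt T3UnitLawDensityEML T3RestrictedUnitDensity T3AlphaInputsAC T3AlphaInputsACSchemas BalabanUVClass
open T3AlphaInputsACTwoRunLevel (LocBlockVolume)
open B10Eq38TorusDomains (IsBlockUnion bdist)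
open Literature.MathematicalPhysics.QuantumFieldTheory.Balaban1983to89.Node00 (regSet canonVersion isOpen_plaqSmall)
open Literature.MathematicalPhysics.QuantumFieldTheory.Balaban1983to89.T3OrbitAverage (orbAvg)
open Summit.QuantumFields.YangMills.Theorems.FluctuationComparisonRegPrIntLS1aAlphaMemVersionOfRows (mem_version_of_alphaRows)
open Summit.QuantumFields.YangMills.Theorems.FluctuationComparisonRegPrIntLS1aInvariantVersion

variable {F : T3Family} {γ : ℝ}

open Classical in
/-- ★★★ **THE (m2) DOOR DOCKED WITH THE ONE-VERSION DOOR** (run `K`, level `k ≤ K`): `BalabanUVClass.Mem (blockAvg ℰp) prm (e^{E_k}·ρ♮)` for the Γ-averaged canonical version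
`ρ♮ = canonVersion dW (orbAvg ρ_k)` of `ρ_k := resDensity F γ K univ k` — `nonneg`, `measurable`, `gaugeInvariant` of the version with NO hypothesis (✓p820698), the sandwich from
the package's OWN `Ineq47AE`∕`Ineq41AE` + «`low K k`, `up K k` continuous on the window» + «window ⊆ regSet» (✓`le_canonVersion_orbAvg_on` ∕ ✓`canonVersion_orbAvg_le_on`, with the a.e. gauge invariance of `ρ_k` from
✓`resDensity_comp_gaugeAct_ae_eq`), everything else as ✓p822164. [cite: Balaban1985UV3, (41)-(47) pp.266-267; Balaban1985Averaging, (12)-(13) p.19] -/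
theorem mem_canonVersion_of_alphaRows (D : AlphaDataT3 F γ) (Wd : LFData D) {b₀ p₀ C κ₁ C' r CD δreg δL cLF c5 : ℝ} {M₁ : ℕ} {K k : ℕ} (hk : k ≤ K)
    -- typed (α) schemas, a.e. rows included
    (hloc : IsLocal D) (hgi : GaugeInv26 D) (hts : TermSize D b₀ p₀ C κ₁) (hdec : PintDecomp D) (hadm : AdmOnSmall D b₀ p₀)
    (hLC : LocCover D κ₁ C') (hEnl : EnlBounded D M₁ r) (hBV : LocBlockVolume D)
    (hM : MainTermIsAction D) (hχ : ChiRange D) (hLF : LFSum D Wd) (h47 : Ineq47AE D K k) (h41 : Ineq41AE D K k)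
    (hr : 0 ≤ r) (hM1 : 1 ≤ M₁) (hMdvd : M₁ ∣ 2 * F.L ^ F.m) (hCD : 0 ≤ CD)
    -- the standing range of the coupling (δ11 is then DISCHARGED: ✓`…S1aLevelLawInvariance.resDensity_comp_gaugeAct_ae_eq`, px17 g20's annex)
    (hγ : 0 ≤ γ)
    -- §67.3 (c): the window lies in the maximal regular set of the density (a continuous representative exists there)
    (hwin : {W : GaugeField (F.P K) k (Matrix.specialUnitaryGroup (Fin 2) ℂ) | PlaqSmall (θBal F.L γ b₀ p₀ (K - k)) W} ⊆
      regSet (fieldMeasure (F.P K) k (Matrix.specialUnitaryGroup (Fin 2) ℂ)) (resDensity F γ K Set.univ k))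
    -- δ7 proper: the socket's minorant ∕ majorant are continuous on the window (print p.263 (c): activities analytic ⟹ continuous)
    (hlowc : ContinuousOn (D.low K k) {W | PlaqSmall (θBal F.L γ b₀ p₀ (K - k)) W})
    (hupc : ContinuousOn (D.up K k) {W | PlaqSmall (θBal F.L γ b₀ p₀ (K - k)) W})
    -- rows the socket lacks (UV3-NODE §69.2 ∕ §69.9), displayed
    (hχ1 : ∀ W : GaugeField (F.P K) k (Matrix.specialUnitaryGroup (Fin 2) ℂ), PlaqSmall (θBal F.L γ b₀ p₀ (K - k)) W → D.χ K k W = 1)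
    (hR0 : ∀ (W : GaugeField (F.P K) k (Matrix.specialUnitaryGroup (Fin 2) ℂ)) v, Wd.wt K k (Wd.trivReg K k) v W = D.χ K k W)
    (hZ : D.Zterm K k (D.triv K k) = 0)
    (hBU : ∀ i, 1 ≤ i → i ≤ k → ∀ Y ∈ D.Loc K k (D.triv K k) i, IsBlockUnion (M₁ * F.L ^ i) Y)
    (hDiam : ∀ i, 1 ≤ i → i ≤ k → ∀ Y ∈ D.Loc K k (D.triv K k) i, ∀ x ∈ Y, ∀ y ∈ Y, bdist (F.P K) M₁ i x y ≤ CD * D.treeLen K i Y)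
    (hsub : ∀ K i (Y : Set (Site (F.P K) 0)), Y ⊆ D.enl K i Y)
    -- δ2-b: UNPRINTED (UV3-NODE l.426 G-K1a-1); removed by δ2-a (RULING №82)
    (hRegClass : ∀ W : GaugeField (F.P K) k (Matrix.specialUnitaryGroup (Fin 2) ℂ), PlaqSmall (θBal F.L γ b₀ p₀ (K - k)) W →
      IsBackground (fun i => BlockAveraging.blockAvg (P := F.P K) (j := i) ℰp) {U | PlaqSmall δreg U} k W (D.Umin K k (D.triv K k) W))
    -- the large-field debt (δ9–δ10 + [B82] §3.C), in `Witness` shape, for this version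
    (hlfle : ∀ W : GaugeField (F.P K) k (Matrix.specialUnitaryGroup (Fin 2) ℂ),
      Real.exp (D.Ecst K k) * (Real.exp (-(D.Ecst K k) + D.Rm K k) * (D.up K k W - D.low K k W)) ≤
        Real.exp (-cLF) * Real.exp (c5 * Fintype.card (Site (F.P K) k)))
    (hlarge : ∀ (W : GaugeField (F.P K) k (Matrix.specialUnitaryGroup (Fin 2) ℂ)) (S : Finset (Plaq (F.P K) k)),
      (∀ p ∈ S, δL ≤ GaugeGroup.dist1 (GaugeField.plaqHol W p)) →
        Real.exp (D.Ecst K k) *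
            canonVersion (fieldMeasure (F.P K) k (Matrix.specialUnitaryGroup (Fin 2) ℂ)) (orbAvg (resDensity F γ K Set.univ k)) W ≤
          Real.exp (-(cLF * S.card)) * Real.exp (c5 * Fintype.card (Site (F.P K) k))) :
    Mem (P := F.P K) (k := k) (fun i => BlockAveraging.blockAvg (P := F.P K) (j := i) ℰp)
      { δ := θBal F.L γ b₀ p₀ (K - k), δreg := δreg, δL := δL, β := (F.scheme ℰp γ).β K, κ := κ₁, M := 2 * r + 18 * M₁ + 3 + CD,
        Ccov := max C 0 * θBal F.L γ b₀ p₀ (K - k + 1) ^ 2 * (2 * max C' 0 * (7 + 2 * r + 18 * M₁) ^ 3), cE := 0, slack := D.Rm K k,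
        cLF := cLF, c5 := c5 }
      (fun W => Real.exp (D.Ecst K k) *
        canonVersion (fieldMeasure (F.P K) k (Matrix.specialUnitaryGroup (Fin 2) ℂ)) (orbAvg (resDensity F γ K Set.univ k)) W) := by
  have hinv : ∀ g : Site (F.P K) k → Matrix.specialUnitaryGroup (Fin 2) ℂ,
      (fun V => resDensity F γ K Set.univ k (GaugeField.gaugeAct g V)) =ᵐ[fieldMeasure (F.P K) k (Matrix.specialUnitaryGroup (Fin 2) ℂ)]
        resDensity F γ K Set.univ k :=
    fun g => Summit.QuantumFields.YangMills.Theorems.FluctuationComparisonRegPrIntLS1aLevelLawInvariance.resDensity_comp_gaugeAct_ae_eq F hγ K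
      (hk.trans (Nat.le_add_left K F.m)) g
  set ρk := resDensity F γ K Set.univ k with hρk
  have hρkm : Measurable ρk := measurable_resDensity F γ K MeasurableSet.univ k
  have hρk0 : ∀ V, 0 ≤ ρk V := resDensity_nonneg F γ K Set.univ k
  have hU : IsOpen {W : GaugeField (F.P K) k (Matrix.specialUnitaryGroup (Fin 2) ℂ) | PlaqSmall (θBal F.L γ b₀ p₀ (K - k)) W} := isOpen_plaqSmall _
  -- (47′)∕(41′) pointwise on the window for the version
  have h47ρ : ∀ W : GaugeField (F.P K) k (Matrix.specialUnitaryGroup (Fin 2) ℂ), PlaqSmall (θBal F.L γ b₀ p₀ (K - k)) W →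
      Real.exp (-(D.Ecst K k) - D.Rm K k) * D.low K k W ≤
        canonVersion (fieldMeasure (F.P K) k (Matrix.specialUnitaryGroup (Fin 2) ℂ)) (orbAvg ρk) W := by
    have hf : ContinuousOn (fun W => Real.exp (-(D.Ecst K k) - D.Rm K k) * D.low K k W)
        {W : GaugeField (F.P K) k (Matrix.specialUnitaryGroup (Fin 2) ℂ) | PlaqSmall (θBal F.L γ b₀ p₀ (K - k)) W} :=
      continuousOn_const.mul hlowc
    exact le_canonVersion_orbAvg_on (N := 2) hρkm.aestronglyMeasurable hinv hU hwin hf (ae_restrict_of_ae h47)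
  have h41ρ : ∀ W : GaugeField (F.P K) k (Matrix.specialUnitaryGroup (Fin 2) ℂ), PlaqSmall (θBal F.L γ b₀ p₀ (K - k)) W →
      canonVersion (fieldMeasure (F.P K) k (Matrix.specialUnitaryGroup (Fin 2) ℂ)) (orbAvg ρk) W ≤
        Real.exp (-(D.Ecst K k) + D.Rm K k) * D.up K k W := by
    have hg : ContinuousOn (fun W => Real.exp (-(D.Ecst K k) + D.Rm K k) * D.up K k W)
        {W : GaugeField (F.P K) k (Matrix.specialUnitaryGroup (Fin 2) ℂ) | PlaqSmall (θBal F.L γ b₀ p₀ (K - k)) W} :=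
      continuousOn_const.mul hupc
    exact canonVersion_orbAvg_le_on (N := 2) hρkm.aestronglyMeasurable hinv hU hwin hg (ae_restrict_of_ae h41)
  exact mem_version_of_alphaRows D Wd hk _ (canonVersion_orbAvg_nonneg (N := 2) hρk0) (measurable_canonVersion_orbAvg (N := 2) hρkm)
    (gaugeInvariant_canonVersion_orbAvg (N := 2) ρk) hloc hgi hts hdec hadm hLC hEnl hBV hM hχ hLF hr hM1 hMdvd hCD h47ρ h41ρ hχ1 hR0 hZ hBU
    hDiam hsub hRegClass hlfle hlarge

end Summit.QuantumFields.YangMills.Theorems.FluctuationComparisonRegPrIntLS1aAlphaMemCanonVersionOfRows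

end
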